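import Mathlib.RingTheory.Algebraic.Basic
import Literature.NumberTheory.Transcendental.KZCalculus
import Literature.NumberTheory.Transcendental.KZLogCalculusProofs
import Literature.NumberTheory.Transcendental.KZTorusLogRep

/-!
# `BetaCancellation` (stmt-KontsevichZagierPeriods-13633), line `dirichlet-companion-to-pi` — stub `stub_catalyst_algebraicPoint`

**A catalyst of non-zero value has an algebraic point at which its integrand does not vanish.**
Let `p = [K, f]` be an integral representation of dimension `d` (a `ℚ`-semialgebraic domain
`K ⊆ ℝᵈ`, a `ℚ`-semialgebraic absolutely integrable integrand `f` on `K`) with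
`p.value = ∫_K f ≠ 0`. Then there is a point `x₀ ∈ K` all of whose coordinates are algebraic over
`ℚ` (indeed rational) with `f x₀ ≠ 0`.

Proof. The non-vanishing set `S = {x ∈ K | f x ≠ 0}` is `ℚ`-semialgebraic (graph elimination,
`IsSemialgebraicFunOn.isSemialgebraic_sep_ne_zero`). If `interior S = ∅` then `S` is Lebesgue-null
(`KZ.volume_eq_zero_of_interior_eq_empty`: a semialgebraic set with empty interior lies in finitely
many zero sets of non-zero polynomials), so `f = 0` almost everywhere on `K` and
`p.value = ∫_K f = 0` (`MeasureTheory.integral_eq_zero_of_ae`), a contradiction. Hence `interior S`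
contains a sup-metric ball `B(y, ε)`, `ε > 0`; choosing rationals `qᵢ ∈ (yᵢ − ε, yᵢ + ε)`
coordinatewise (`exists_rat_btwn`, `dist_pi_lt_iff`) gives a rational point `x₀ = (qᵢ)ᵢ ∈ S`, and
rationals are algebraic (`isAlgebraic_algebraMap`). The argument is uniform in `d` (for `d = 0` the
ball is the point `ℝ⁰`). No definitions; sorry-free; axioms ⊆ {propext, Classical.choice, Quot.sound}.

References: J. Bochnak, M. Coste, M.-F. Roy, *Real Algebraic Geometry* (1998), §2.2 (graph
elimination) and §2.8 (dimension: semialgebraic sets with empty interior are thin);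
M. Kontsevich, D. Zagier, *Periods* (2001), §1.1.
-/

noncomputable section

-- `Summit.KontsevichZagierPeriods.KontsevichZagierPeriods.…` is the tree's mandated layout (single-conjunct summit).
set_option linter.dupNamespace false

namespace Summit.KontsevichZagierPeriods.KontsevichZagierPeriods.BetaCancellationLine

open Set MeasureTheory Metric
open Literature.NumberTheory.Transcendental
open Literature.NumberTheory.Transcendental.KZ

/-! ### The non-vanishing set of a catalyst of non-zero value is not thin -/

/-- If the integrand of an integral representation `p = [K, f]` vanishes outside a null subset of
`K`, i.e. `{x ∈ K | f x ≠ 0}` is Lebesgue-null, then `p.value = ∫_K f = 0`. [folklore] -/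
theorem catalyst_value_eq_zero_of_volume_sep_ne_zero {d : ℕ} (p : IntegralRep d)
    (hvol : volume {x | x ∈ p.domain ∧ p.integrand x ≠ 0} = 0) : p.value = 0 := by
  have hDm : MeasurableSet p.domain := IntegralRep.measurableSet_domain_holds p
  have hae : ∀ᵐ x ∂(volume.restrict p.domain), p.integrand x = 0 := by
    rw [ae_restrict_iff' hDm, ae_iff]
    convert hvol using 2
    ext x
    simp [Classical.not_imp]
  exact integral_eq_zero_of_ae hae

/-- For an integral representation `p = [K, f]` of non-zero value, the `ℚ`-semialgebraic
non-vanishing set `{x ∈ K | f x ≠ 0}` has non-empty interior: otherwise it is null (a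
`ℚ`-semialgebraic set with empty interior is null, `KZ.volume_eq_zero_of_interior_eq_empty`) and the
value vanishes. [cite: BochnakCosteRoy1998, §2.8] -/
theorem catalyst_interior_sep_ne_zero_nonempty {d : ℕ} (p : IntegralRep d) (hp : p.value ≠ 0) :
    (interior {x | x ∈ p.domain ∧ p.integrand x ≠ 0}).Nonempty := by
  by_contra hne
  rw [not_nonempty_iff_eq_empty] at hne
  have hSsa : Literature.ModelTheory.ExponentialFields.IsSemialgebraic ℚ
      {x | x ∈ p.domain ∧ p.integrand x ≠ 0} :=
    p.isSemialgebraicFunOn_integrand.isSemialgebraic_sep_ne_zero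
  exact hp (catalyst_value_eq_zero_of_volume_sep_ne_zero p
    (volume_eq_zero_of_interior_eq_empty hSsa hne))

/-! ### Rational points in sup-metric balls -/

/-- Every open sup-metric ball of `ℝᵈ` (`d ≥ 0`) contains a point with rational coordinates:
choose a rational in each coordinate interval `(yᵢ − ε, yᵢ + ε)`. [folklore] -/
theorem exists_ratCast_mem_ball {d : ℕ} (y : Fin d → ℝ) {ε : ℝ} (hε : 0 < ε) :
    ∃ q : Fin d → ℚ, (fun i => ((q i : ℚ) : ℝ)) ∈ ball y ε := by
  have h : ∀ i, ∃ q : ℚ, dist ((q : ℚ) : ℝ) (y i) < ε := fun i => by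
    obtain ⟨q, hq₁, hq₂⟩ := exists_rat_btwn (show y i - ε < y i + ε by linarith)
    refine ⟨q, ?_⟩
    rw [Real.dist_eq, abs_lt]
    constructor <;> linarith
  choose q hq using h
  refine ⟨q, ?_⟩
  rw [mem_ball, dist_pi_lt_iff hε]
  exact hq

/-! ### The stub -/

/-- STUB (seat c14, cycle 2). A catalyst of non-zero value has a point with algebraic coordinates in
its domain at which the integrand does not vanish: `{x ∈ p.domain | p.integrand x ≠ 0}` is
`ℚ`-semialgebraic and not null (else `p.value = 0`), hence has non-empty interior
(`volume_eq_zero_of_interior_eq_empty`), hence contains a point with rational coordinates, and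
rationals are algebraic over `ℚ`. [cite: BochnakCosteRoy1998, §2.8] -/
theorem stub_catalyst_algebraicPoint {d : ℕ} (p : IntegralRep d) (hp : p.value ≠ 0) :
    ∃ x₀ ∈ p.domain, (∀ i, IsAlgebraic ℚ (x₀ i)) ∧ p.integrand x₀ ≠ 0 := by
  obtain ⟨y, hy⟩ := catalyst_interior_sep_ne_zero_nonempty p hp
  obtain ⟨ε, hε, hball⟩ := Metric.isOpen_iff.1 isOpen_interior y hy
  obtain ⟨q, hq⟩ := exists_ratCast_mem_ball y hε
  have hqS : (fun i => ((q i : ℚ) : ℝ)) ∈ {x | x ∈ p.domain ∧ p.integrand x ≠ 0} :=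
    interior_subset (hball hq)
  exact ⟨fun i => ((q i : ℚ) : ℝ), hqS.1, fun i => isAlgebraic_algebraMap (q i), hqS.2⟩

end Summit.KontsevichZagierPeriods.KontsevichZagierPeriods.BetaCancellationLine

end
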